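import Summits.HodgeConjecture.HodgeConjecture.Theorems.MarkmanPartnerTransportLowPicardRMGenerator
import Summits.HodgeConjecture.HodgeConjecture.Theorems.MarkmanPartnerTransportK3Sq2OneCycleIsometries
import Summits.HodgeConjecture.HodgeConjecture.Theses.MarkmanPartnerTransport
import Summits.HodgeConjecture.HodgeConjecture.Theorems.MarkmanPartnerTransportLowPicardRMExact

/-!
# Route MarkmanPartnerTransport · crux #5 `LowPicardRealMultiplication` — «RM-GEN»: genuine real multiplication
# comes with a GENERATOR `θ` of its endomorphism field, `E = End_Hdg(T(X)_ℚ) = ℚ(θ|_T)`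

Strengthening of `exists_realMultiplication_degree_of_not_spannedByIsometries` (`…K3Sq2RealMultiplicationDegree`),
programme «RM-GEN + CELL-SPLIT» of the cell hodge-nonav (planner p1 g38, Sketch P1AK-CELLS). For a marked smooth
projective `K3^{[2]}`-type fourfold `(X, φ, P, z)` with `¬ SpannedByIsometries X φ`, the endomorphism field
`E = End_Hdg(T(X)_ℚ)` of the period datum is a totally real number field `≠ ℚ` (Zarhin); a PRIMITIVE ELEMENT `r₀` of
`E/ℚ` (`Field.powerBasisOfFiniteOfSeparable`), extended by `id_N` and complexified in the marking, is a rational,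
type-preserving, `q`-SELF-ADJOINT endomorphism `θ` of `H²(X(ℂ); ℂ)` with `θ σ = ev · σ`, `ev = ε(r₀)` real,
`d := deg minpoly_ℚ(ev) = [E : ℚ] ≥ 2`, `d · n + ρ(X) = 23` for some `n ≥ 3` (van Geemen), and — GEN — EVERY
rational type-preserving endomorphism `f` of `H²(X(ℂ); ℂ)` is a rational polynomial of degree `< d` in `θ` on the
`q`-transcendental space `T(X)_ℂ = N¹(X)^{⊥_q}` (`f|_T ∈ E = ⊕_{i<d} ℚ r₀ⁱ`, power basis):

* `exists_rmGenerator_of_not_spannedByIsometries` — **«RM-GEN»**: `∃ d ≥ 2, RMgen[X, φ, z, d]` (the abstract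
  inputs — primitive element `exists_generator_endAlg`, self-adjointness `isAdjointPair_self_of_real`,
  `B_extendT_selfAdjoint`, `form_cxEnd_selfAdjoint` — are in `…LowPicardRMGenerator`);
* `cell_cases`, `lowPicardRealMultiplication_of_six_cells` — **«CELL-SPLIT»**: `ρ(X) ≤ 3`, `d ≥ 2`, `n ≥ 3`,
  `d · n + ρ(X) = 23` force `(ρ(X), d) ∈ {(1,2), (2,3), (2,7), (3,2), (3,4), (3,5)}` (`ρ = 0` dies on `23` prime), so
  the route declaration `LowPicardRealMultiplication` is BY NAME the conjunction of HC⁴ on its six cells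
  `CellHC[ρ, d]` (cells cut by the DEGREE OF THE FIELD `E`, i.e. by `RMgen`, not by «∃ e of degree d»).

`RMgen[X, φ, z, d]` is the cell vocabulary of memo ROUTE-P1AK (the `RMGenData` of Sketch P1AK-CELLS, with the
self-adjointness clause ADDED and the `T`-membership test spelled `q(φ y, φ N¹) = 0` as in `SpannedByIsometries`); its
GEN clause is the polynomial `hgen` binder of `OrphanSR.hodgeConjectureFor_of_endomorphismField_of_semiregularSeed`
and of KAPPA-ANY (`…HodgeClassesModKappaClassesAnyDegree`). No definition, no sorry, no named-fact hypothesis.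
Prover seat hodge-nonav-20241-p1 (gen 14), `--supports stmt-HodgeConjecture-19653`. Nothing here proves the crux
or HC.

References: Yu. Zarhin, J. reine angew. Math. 341 (1983) Thm. 1.5.1, Thm. 1.6; B. van Geemen, Michigan Math. J. 56
(2008) Lemma 3.2; D. Huybrechts, *Lectures on K3 Surfaces*, Ch. 3 Thm. 3.3.7, Lemma 3.3.1; C. Voisin, *Hodge Theory
I*, §7.1.1.
-/

noncomputable section

set_option linter.dupNamespace false

open scoped TensorProduct
open Module CategoryTheory Polynomial
open Literature.AlgebraicTopology.SingularHomology Literature.Geometry.Kaehler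
open Literature.AlgebraicGeometry Literature.AlgebraicGeometry.Motives Literature.AlgebraicGeometry.HodgeTheory
open Literature.AlgebraicGeometry.Motives.HodgeStructure
open Literature.AlgebraicGeometry.Hyperkaehler Literature.AlgebraicGeometry.Surfaces
open Summit.HodgeConjecture.HodgeConjecture.Theorems.NikulinTwinTransport
open Summit.HodgeConjecture.HodgeConjecture.Theorems.MarkmanPartnerTransport.BBFPositivity
open Summit.HodgeConjecture.HodgeConjecture.Theorems.MarkmanPartnerTransport.LatticeBridge
open Summit.HodgeConjecture.HodgeConjecture.Theorems.MarkmanPartnerTransport.RealMultiplicationRanks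

namespace Summit.HodgeConjecture.HodgeConjecture.Theorems.MarkmanPartnerTransport.PartnerLattice

/-- `MarkedK3Sq[X, φ, P, z]`: VERBATIM the `let MarkedK3Sq := …` binder of the route declarations of
MarkmanPartnerTransport (clauses (m1)–(m6)). Local notation only. -/
local notation3 (prettyPrint := false) "MarkedK3Sq[" X ", " φ ", " P ", " z "]" =>
  (((IsIntegralClass P ∧ ∀ Q : complexBetti X (2 * 4), IsIntegralClass Q → ∃ n : ℤ, Q = n • P) ∧
    (∀ c : complexBetti X 2, IsIntegralClass c ↔ ∃ v : K3HilbertIndex → ℤ, φ c = fun i => (v i : ℂ)) ∧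
    (∀ a : complexBetti X 2, cupPowTwo a 4 = ((3 : ℂ) * (k3HilbertForm 2 (φ a) (φ a)) ^ 2) • P) ∧
    (IsOfHodgeType 4 X 2 2 0 (LinearEquiv.symm φ z) ∧
      ∀ τ : complexBetti X 2, IsOfHodgeType 4 X 2 2 0 τ → ∃ t : ℂ, τ = t • LinearEquiv.symm φ z) ∧
    (∀ c : complexBetti X 2, IsOfHodgeType 4 X 2 1 1 c ↔
      (k3HilbertForm 2 (φ c) z = 0 ∧ k3HilbertForm 2 (φ c) (star z) = 0)) ∧
    (k3HilbertForm 2 z z = 0 ∧ 0 < (k3HilbertForm 2 (star z) z).re)))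

/-- `SpIso[X, φ]`: VERBATIM the `let SpannedByIsometries := …` binder of the route declarations (with
`IsBBFTransc` unfolded). Local notation only. -/
local notation3 (prettyPrint := false) "SpIso[" X ", " φ "]" =>
  (∀ f : complexBetti X 2 →ₗ[ℂ] complexBetti X 2, (∀ y, IsRationalClass y → IsRationalClass (f y)) →
    (∀ (i j : ℕ) y, IsOfHodgeType 4 X 2 i j y → IsOfHodgeType 4 X 2 i j (f y)) →
    (∀ d : complexBetti X 2, d ∈ algebraicClasses X 1 → f d = 0) →
    (∀ y : complexBetti X 2, ∀ d : complexBetti X 2, d ∈ algebraicClasses X 1 →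
      k3HilbertForm 2 (φ (f y)) (φ d) = 0) →
    ∃ (k : ℕ) (c : Fin k → ℚ) (g : Fin k → (complexBetti X 2 →ₗ[ℂ] complexBetti X 2)),
      (∀ i, Function.Bijective (g i) ∧ (∀ y, IsRationalClass y → IsRationalClass (g i y)) ∧
        (∀ (a b : ℕ) y, IsOfHodgeType 4 X 2 a b y → IsOfHodgeType 4 X 2 a b (g i y)) ∧
        (∀ a b, k3HilbertForm 2 (φ (g i a)) (φ (g i b)) = k3HilbertForm 2 (φ a) (φ b))) ∧
      ∀ y : complexBetti X 2, (∀ d : complexBetti X 2, d ∈ algebraicClasses X 1 →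
        k3HilbertForm 2 (φ y) (φ d) = 0) → f y = ∑ i : Fin k, ((c i : ℂ) • g i y))

/-- `RMgen[X, φ, z, d]` («RMgen» data, the `RMGenData` of Sketch P1AK-CELLS with self-adjointness added): a
rational, type-preserving, `q`-self-adjoint endomorphism `θ` of `H²(X(ℂ); ℂ)` with `θ σ = ev · σ`, `ev` real,
`deg minpoly_ℚ(ev) = d`, `d · n + ρ(X) = 23` for some `n ≥ 3`, and GEN: every rational type-preserving endomorphism
is `Σ_{i<d} cᵢ θⁱ` (`cᵢ ∈ ℚ`) on `T(X)_ℂ = {y : q(φ y, φ N¹(X)) = 0}`. Local notation only. -/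
local notation3 (prettyPrint := false) "RMgen[" X ", " φ ", " z ", " d "]" =>
  (∃ θ : complexBetti X 2 →ₗ[ℂ] complexBetti X 2, (∀ y, IsRationalClass y → IsRationalClass (θ y)) ∧
    (∀ (i j : ℕ) y, IsOfHodgeType 4 X 2 i j y → IsOfHodgeType 4 X 2 i j (θ y)) ∧
    (∀ y w : complexBetti X 2, k3HilbertForm 2 (φ (θ y)) (φ w) = k3HilbertForm 2 (φ y) (φ (θ w))) ∧
    ∃ ev : ℂ, θ (LinearEquiv.symm φ z) = ev • LinearEquiv.symm φ z ∧ ev.im = 0 ∧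
      (minpoly ℚ ev).natDegree = d ∧
      (∃ n : ℕ, 3 ≤ n ∧ d * n + Module.finrank ℂ ↥(algebraicClasses X 1) = 23) ∧
      ∀ f : complexBetti X 2 →ₗ[ℂ] complexBetti X 2, (∀ y, IsRationalClass y → IsRationalClass (f y)) →
        (∀ (i j : ℕ) y, IsOfHodgeType 4 X 2 i j y → IsOfHodgeType 4 X 2 i j (f y)) →
        ∃ c : Fin d → ℚ, ∀ y : complexBetti X 2,
          (∀ a : complexBetti X 2, a ∈ algebraicClasses X 1 → k3HilbertForm 2 (φ y) (φ a) = 0) →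
            f y = ∑ i : Fin d, ((c i : ℂ) • (θ ^ (i : ℕ)) y))

/-- `qQ`: the rational Beauville–Bogomolov form on `ℚ²³`. -/
local notation3 (prettyPrint := false) "qQ" => Matrix.toBilin' (Matrix.map (k3HilbertGram 2) (Int.cast : ℤ → ℚ))

/-- `qC`: the complex Beauville–Bogomolov form on `ℂ²³`. -/
local notation3 (prettyPrint := false) "qC" => Matrix.toBilin' (Matrix.map (k3HilbertGram 2) (Int.cast : ℤ → ℂ))

variable {X : SchemeOver ℂ} {φ : complexBetti X 2 ≃ₗ[ℂ] (K3HilbertIndex → ℂ)} {P : complexBetti X (2 * 4)}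
  {z : K3HilbertIndex → ℂ}

/-- **«RM-GEN»: genuine real multiplication comes with a generator of its endomorphism field** (module docstring):
under `¬ SpannedByIsometries X φ` there are `d ≥ 2` and `RMgen[X, φ, z, d]`. Marking picture: `D` the period datum,
`E = End_Hdg(T)` a totally real field (a non-real character value would force `SpannedByIsometries`) containing some
`r ∉ ℚ` (the real-multiplication endomorphism of `…K3Sq2RealMultiplicationResidue`); `θ := φ⁻¹ ∘ (r₀ ⊕ id_N)_ℂ ∘ φ`
for a primitive element `r₀`: rational (`cxEnd_ratVec`), type-preserving (`typePreserving_of_markedSq`), self-adjoint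
(`isAdjointPair_self_of_real`, `B_extendT_selfAdjoint`, `form_cxEnd_selfAdjoint`), `θ σ = ε(r₀) σ`; GEN: a rational
type-preserving `f` reads as `r_f ∈ E` (`exists_ratEnd_of_eigen_of_oneOne`, `restrict_mem_endAlg`), `r_f = Σ cᵢ r₀ⁱ`,
transported to `T(X)_ℂ = ι_T(ℂ ⊗ T)` along `cxEnd`. [cite: Zarhin1983HodgeGroupsK3, Thm. 1.5.1 and Thm. 1.6]
[cite: Vangeemen2008, Lemma 3.2] [cite: Huybrechts2016K3, Ch. 3 Thm. 3.3.7 and Lemma 3.3.1] -/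
theorem exists_rmGenerator_of_not_spannedByIsometries (hX : IsSmoothProjective 4 X)
    (hM : MarkedK3Sq[X, φ, P, z]) (hnsp : ¬ SpIso[X, φ]) : ∃ d : ℕ, 2 ≤ d ∧ RMgen[X, φ, z, d] := by
  classical
  obtain ⟨-, hint, -, ⟨hz20, hz20'⟩, h11, hzz, hzpos⟩ := id hM
  obtain ⟨NQ, hNQ⟩ := exists_ratNeronSeveri (X := X) φ
  set D := periodDatum hX hM hNQ with hDdef
  have hDT : D.T = (qQ).orthogonal NQ := rfl
  have hDx : D.x = z := rfl
  have hDBC : ∀ a b, D.BC a b = k3HilbertForm 2 a b := fun a b => qC_apply a b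
  clear_value D
  have hzne : z ≠ 0 := by
    intro h0
    rw [h0, k3HilbertForm_eq_dotProduct] at hzpos
    simp at hzpos
  set H := D.hodgeT with hH
  have hK3 : H.IsOfK3Type := D.isOfK3Type_hodgeT
  have hirr : H.IsIrreducible := D.isIrreducible_hodgeT
  set ψ : H.Polarization := D.polT with hψ
  obtain ⟨hFld, ε, hεinj, hε⟩ := Zarhin1983_endAlg_isField_holds H hirr hK3
  have hω : D.omega ∈ H.piece 2 0 := D.omega_mem_piece
  have hrat : ∀ c, IsRationalClass c ↔ ∃ w : K3HilbertIndex → ℚ, φ c = fun i => (w i : ℂ) :=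
    isRationalClass_iff_of_markedSq hX hint
  -- `dim_ℚ T = 23 - ρ(X)`
  have hdimT : Module.finrank ℚ ↥D.T + Module.finrank ℂ ↥(algebraicClasses X 1) = 23 := by
    have h := Submodule.finrank_add_eq_of_isCompl (isCompl_ratNeronSeveri_orthogonal hX hM hNQ)
    rw [finrank_ratNeronSeveri hX hint hNQ, finrank_rat23] at h
    rw [hDT]
    omega
  -- reading a rational endomorphism with `σ` as eigenvector and preserving `(1,1)` in `E`, with its `ε`-value
  have read : ∀ (G : complexBetti X 2 →ₗ[ℂ] complexBetti X 2) (c : ℂ),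
      (∀ y, IsRationalClass y → IsRationalClass (G y)) → G (φ.symm z) = c • φ.symm z →
      (∀ y, IsOfHodgeType 4 X 2 1 1 y → IsOfHodgeType 4 X 2 1 1 (G y)) →
      ∃ (τ : Module.End ℚ (K3HilbertIndex → ℚ)) (hτT : ∀ t ∈ D.T, τ t ∈ D.T) (hr : τ.restrict hτT ∈ H.endAlg),
        cxEnd τ = φ.toLinearMap ∘ₗ G ∘ₗ φ.symm.toLinearMap ∧ ε ⟨τ.restrict hτT, hr⟩ = c := by
    intro G c hG_rat hGσ hG11
    obtain ⟨τ, hτM, hτx, hτ11⟩ := exists_ratEnd_of_eigen_of_oneOne hX hM G hG_rat ⟨c, hGσ⟩ hG11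
    have hτx' : ∃ c : ℂ, cxEnd τ D.x = c • D.x := by rw [hDx]; exact hτx
    have hτ11' : ∀ w : K3HilbertIndex → ℂ, D.BC w D.x = 0 → D.BC w (star D.x) = 0 →
        D.BC (cxEnd τ w) D.x = 0 ∧ D.BC (cxEnd τ w) (star D.x) = 0 := by
      intro w h1 h2
      rw [hDBC, hDx] at h1 h2
      rw [hDBC, hDBC, hDx]
      exact hτ11 w h1 h2
    have hτT : ∀ t ∈ D.T, τ t ∈ D.T := fun t ht => D.map_mem_T τ hτx' ht
    have hr : τ.restrict hτT ∈ H.endAlg := D.restrict_mem_endAlg τ hτT hτx' hτ11'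
    have hτMapp : ∀ v, cxEnd τ v = φ (G (φ.symm v)) := fun v => by rw [hτM]; rfl
    refine ⟨τ, hτT, hr, hτM, ?_⟩
    have h := hε ⟨τ.restrict hτT, hr⟩ D.omega hω
    have h2 := congrArg (iota D.T) h
    have hval : ((⟨τ.restrict hτT, hr⟩ : H.endAlg) : Module.End ℚ ↥D.T) = τ.restrict hτT := rfl
    rw [hval, D.iota_baseChange_restrict τ hτT, D.iota_omega, map_smul, D.iota_omega, hDx, hτMapp, hGσ, map_smul,
      LinearEquiv.apply_symm_apply] at h2
    have h3 : (c - ε ⟨τ.restrict hτT, hr⟩) • z = 0 := by rw [sub_smul, h2, sub_self]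
    rcases smul_eq_zero.1 h3 with h4 | h4
    · exact (sub_eq_zero.1 h4).symm
    · exact absurd h4 hzne
  -- an element of `E` outside `ℚ`: the real-multiplication endomorphism
  obtain ⟨e, he_rat, he_typ, ev₀, he_ev, -, hev_irr⟩ :=
    exists_realMultiplication_of_not_spannedByIsometries hX hM hnsp
  obtain ⟨τe, hτeT, hre, -, hεr⟩ := read e ev₀ he_rat he_ev (fun y hy => he_typ 1 1 y hy)
  have hr_bot : (⟨τe.restrict hτeT, hre⟩ : H.endAlg) ∉ (⊥ : Subalgebra ℚ H.endAlg) := by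
    intro h
    rw [Algebra.mem_bot] at h
    obtain ⟨a, ha⟩ := h
    apply hev_irr a
    rw [← hεr, ← ha, AlgHom.commutes, eq_ratCast]
  -- `E` is totally real: a non-real character value would force `SpannedByIsometries`
  have hreal : ∀ (φ' : H.endAlg →+* ℂ) (a : H.endAlg), starRingEnd ℂ (φ' a) = φ' a := by
    by_contra hnot
    push Not at hnot
    obtain ⟨φ', a, hφ'a⟩ := hnot
    obtain ⟨hadjex, hadjconj⟩ := Zarhin1983_adjoint_eq_conj_holds H hirr hK3 ψ
    obtain ⟨a', ha'⟩ := hadjex a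
    have hne : a' ≠ a := by
      intro h
      apply hφ'a
      have key := hadjconj a a' ha' φ'
      rw [h] at key
      exact key.symm
    have hμ : (ε a).im ≠ 0 := by
      intro him
      apply hne
      apply hεinj
      have key := hadjconj a a' ha' ε.toRingHom
      change ε a' = starRingEnd ℂ (ε a) at key
      rw [key]
      exact Complex.conj_eq_iff_im.2 him
    set û : Module.End ℚ (K3HilbertIndex → ℚ) := D.extendT (a : Module.End ℚ ↥D.T) with hû
    have hûz : cxEnd û z = ε a • z := by
      have h := hε a D.omega hω
      have h2 := congrArg (iota D.T) h
      rw [D.iota_baseChange, D.iota_omega, map_smul, D.iota_omega, hDx] at h2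
      exact h2
    have hû11 : ∀ w : K3HilbertIndex → ℂ, k3HilbertForm 2 w z = 0 → k3HilbertForm 2 w (star z) = 0 →
        k3HilbertForm 2 (cxEnd û w) z = 0 ∧ k3HilbertForm 2 (cxEnd û w) (star z) = 0 := by
      intro w h1 h2
      have h := D.BC_cxEnd_extendT a.2 (z := w) (by rw [hDBC, hDx]; exact h1) (by rw [hDBC, hDx]; exact h2)
      rwa [hDBC, hDBC, hDx] at h
    let Ψ : complexBetti X 2 →ₗ[ℂ] complexBetti X 2 := φ.symm.toLinearMap ∘ₗ cxEnd û ∘ₗ φ.toLinearMap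
    have hΨapp : ∀ y, Ψ y = φ.symm (cxEnd û (φ y)) := fun y => rfl
    have hΨrat : ∀ y, IsRationalClass y → IsRationalClass (Ψ y) := by
      intro y hy
      obtain ⟨w, hw⟩ := (hrat y).1 hy
      rw [hΨapp, hw, cxEnd_ratVec]
      exact (hrat _).2 ⟨û w, LinearEquiv.apply_symm_apply _ _⟩
    have hΨσ : Ψ (φ.symm z) = ε a • φ.symm z := by rw [hΨapp, LinearEquiv.apply_symm_apply, hûz, map_smul]
    have hΨ11 : ∀ y, IsOfHodgeType 4 X 2 1 1 y → IsOfHodgeType 4 X 2 1 1 (Ψ y) := by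
      intro y hy
      obtain ⟨h1, h2⟩ := (h11 y).1 hy
      rw [hΨapp, h11, LinearEquiv.apply_symm_apply]
      exact hû11 (φ y) h1 h2
    exact hnsp (spannedByIsometries_of_cm hX hM Ψ hΨrat hΨ11 hΨσ hμ)
  -- the primitive element `r₀` of `E` with its degree data
  obtain ⟨r₀, d, hd, hd2, ⟨n, hn, hdimn⟩, hgenE⟩ := exists_generator_endAlg hirr hK3 ψ hFld hreal ε hεinj hr_bot
  -- `r₀` is self-adjoint on `T`, hence `û := r₀ ⊕ id_N` on `ℚ²³` and `û_ℂ` on `ℂ²³`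
  have hsaψ := isAdjointPair_self_of_real hirr hK3 ψ ε hεinj hreal r₀
  have hsaT : ∀ v w : ↥D.T, D.B ((r₀ : Module.End ℚ ↥D.T) v) w = D.B v ((r₀ : Module.End ℚ ↥D.T) w) := by
    intro v w
    have h' : ψ.form ((r₀ : Module.End ℚ ↥D.T) v) w = ψ.form v ((r₀ : Module.End ℚ ↥D.T) w) := hsaψ v w
    change (-(D.B.restrict D.T)) _ _ = (-(D.B.restrict D.T)) _ _ at h'
    rw [LinearMap.neg_apply, LinearMap.neg_apply, LinearMap.neg_apply, LinearMap.neg_apply, neg_inj,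
      LinearMap.BilinForm.restrict_apply, LinearMap.domRestrict_apply, LinearMap.BilinForm.restrict_apply,
      LinearMap.domRestrict_apply] at h'
    exact h'
  set û : Module.End ℚ (K3HilbertIndex → ℚ) := D.extendT (r₀ : Module.End ℚ ↥D.T) with hû
  have hûsa : ∀ v w, D.B (û v) w = D.B v (û w) := fun v w => D.B_extendT_selfAdjoint _ hsaT v w
  have hûsaC : ∀ a b : K3HilbertIndex → ℂ, D.BC (cxEnd û a) b = D.BC a (cxEnd û b) :=
    form_cxEnd_selfAdjoint D.ratCast_form û hûsa
  have hûz : cxEnd û z = ε r₀ • z := by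
    have h := hε r₀ D.omega hω
    have h2 := congrArg (iota D.T) h
    rw [D.iota_baseChange, D.iota_omega, map_smul, D.iota_omega, hDx] at h2
    exact h2
  have hû11 : ∀ w : K3HilbertIndex → ℂ, k3HilbertForm 2 w z = 0 → k3HilbertForm 2 w (star z) = 0 →
      k3HilbertForm 2 (cxEnd û w) z = 0 ∧ k3HilbertForm 2 (cxEnd û w) (star z) = 0 := by
    intro w h1 h2
    have h := D.BC_cxEnd_extendT r₀.2 (z := w) (by rw [hDBC, hDx]; exact h1) (by rw [hDBC, hDx]; exact h2)
    rwa [hDBC, hDBC, hDx] at h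
  -- powers of `û` on `T` are the powers of `r₀`
  have hûpow : ∀ (k : ℕ) (t' : ↥D.T),
      ((((r₀ : Module.End ℚ ↥D.T) ^ k) t' : ↥D.T) : K3HilbertIndex → ℚ) = (û ^ k) (t' : K3HilbertIndex → ℚ) := by
    intro k
    induction k with
    | zero => intro t'; rw [pow_zero, pow_zero, Module.End.one_apply, Module.End.one_apply]
    | succ k ih =>
      intro t'
      rw [pow_succ', pow_succ', Module.End.mul_apply, Module.End.mul_apply, ← ih, hû, D.extendT_apply_coe]
  -- the generator `θ := φ⁻¹ ∘ û_ℂ ∘ φ`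
  let θ : complexBetti X 2 →ₗ[ℂ] complexBetti X 2 := φ.symm.toLinearMap ∘ₗ cxEnd û ∘ₗ φ.toLinearMap
  have hθapp : ∀ y, θ y = φ.symm (cxEnd û (φ y)) := fun y => rfl
  have hθrat : ∀ y, IsRationalClass y → IsRationalClass (θ y) := by
    intro y hy
    obtain ⟨w, hw⟩ := (hrat y).1 hy
    rw [hθapp, hw, cxEnd_ratVec]
    exact (hrat _).2 ⟨û w, LinearEquiv.apply_symm_apply _ _⟩
  have hθσ : θ (φ.symm z) = ε r₀ • φ.symm z := by rw [hθapp, LinearEquiv.apply_symm_apply, hûz, map_smul]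
  have hθtyp : ∀ (i j : ℕ) y, IsOfHodgeType 4 X 2 i j y → IsOfHodgeType 4 X 2 i j (θ y) := by
    intro i j y hy
    rw [hθapp]
    exact typePreserving_of_markedSq hX hM (cxEnd û) (cxEnd_star û) ⟨ε r₀, hûz⟩ hû11 i j y hy
  have hθsa : ∀ y w : complexBetti X 2, k3HilbertForm 2 (φ (θ y)) (φ w) = k3HilbertForm 2 (φ y) (φ (θ w)) := by
    intro y w
    rw [hθapp, hθapp, LinearEquiv.apply_symm_apply, LinearEquiv.apply_symm_apply, ← hDBC, ← hDBC]
    exact hûsaC _ _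
  have hθpow : ∀ (k : ℕ) (y : complexBetti X 2), (θ ^ k) y = φ.symm ((cxEnd û ^ k) (φ y)) := by
    intro k
    induction k with
    | zero => intro y; rw [pow_zero, pow_zero, Module.End.one_apply, Module.End.one_apply, LinearEquiv.symm_apply_apply]
    | succ k ih =>
      intro y
      rw [pow_succ', pow_succ', Module.End.mul_apply, Module.End.mul_apply, ih, hθapp, LinearEquiv.apply_symm_apply]
  -- the data
  refine ⟨d, hd2, θ, hθrat, hθtyp, hθsa, ε r₀, hθσ, Complex.conj_eq_iff_im.1 (hreal ε.toRingHom r₀), hd,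
    ⟨n, hn, by rw [← hdimn]; exact hdimT⟩, ?_⟩
  -- GEN
  intro f hf_rat hf_typ
  obtain ⟨t, ht⟩ := hz20' _ (hf_typ 2 0 _ hz20)
  obtain ⟨τf, hτfT, hrf, hτfM, -⟩ := read f t hf_rat ht (fun y hy => hf_typ 1 1 y hy)
  have hτfMapp : ∀ v, cxEnd τf v = φ (f (φ.symm v)) := fun v => by rw [hτfM]; rfl
  obtain ⟨c, hc⟩ := hgenE ⟨τf.restrict hτfT, hrf⟩
  refine ⟨c, fun y hy => ?_⟩
  have hTeq : ∀ t' : ↥D.T, τf (t' : K3HilbertIndex → ℚ) = ∑ i : Fin d, c i • (û ^ (i : ℕ)) (t' : K3HilbertIndex → ℚ) := by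
    intro t'
    have hval : ((⟨τf.restrict hτfT, hrf⟩ : H.endAlg) : Module.End ℚ ↥D.T) = τf.restrict hτfT := rfl
    have h2 := congrArg Subtype.val (LinearMap.congr_fun hc t')
    rw [hval, LinearMap.coe_restrict_apply, LinearMap.sum_apply, Submodule.coe_sum] at h2
    rw [h2]
    refine Finset.sum_congr rfl fun i _ => ?_
    rw [LinearMap.smul_apply, Submodule.coe_smul, hûpow]
  have hcx : ∀ w : ℂ ⊗[ℚ] ↥D.T, cxEnd τf (iota _ w) = ∑ i : Fin d, ((c i : ℚ) : ℂ) • cxEnd (û ^ (i : ℕ)) (iota _ w) := by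
    intro w
    induction w using TensorProduct.induction_on with
    | zero => simp only [map_zero, smul_zero, Finset.sum_const_zero]
    | tmul a t' =>
      rw [iota_tmul, map_smul, cxEnd_ratVec, hTeq t', ratCastVec_sum, Finset.smul_sum]
      refine Finset.sum_congr rfl fun i _ => ?_
      rw [ratCastVec_smul, ← cxEnd_ratVec, map_smul, smul_comm]
    | add z₁ z₂ h₁ h₂ =>
      rw [map_add, map_add, h₁, h₂, ← Finset.sum_add_distrib]
      refine Finset.sum_congr rfl fun i _ => ?_
      rw [map_add, smul_add]
  have hyT : φ y ∈ Submodule.span ℂ (Set.range fun t : ↥D.T => fun i => (((t : K3HilbertIndex → ℚ) i : ℚ) : ℂ)) := by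
    have h := (mem_span_ratTransc_iff hX hint hNQ (φ y)).2 hy
    rw [Set.image_eq_range] at h
    rw [hDT]
    exact h
  have hzι : iota _ (lam D.isCompl (φ y)) = φ y := iota_lam_of_mem_span D.isCompl hyT
  have hfy : f y = φ.symm (cxEnd τf (φ y)) := by
    rw [hτfMapp, LinearEquiv.symm_apply_apply, LinearEquiv.symm_apply_apply]
  rw [hfy, ← hzι, hcx, hzι, map_sum]
  refine Finset.sum_congr rfl fun i _ => ?_
  rw [map_smul, hθpow, cxEnd_pow]

/-! ### «CELL-SPLIT»: crux #5 is the conjunction of its six cells -/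

/-- `CellHC[ρ, d]`: **HC⁴ on the cell `(ρ(X), [E:ℚ]) = (ρ, d)`** — for every marked smooth projective `K3^{[2]}`-type
`(X, φ, P, z)` with `¬ SpannedByIsometries`, `ρ(X) = ρ` and `RMgen[X, φ, z, d]` (the `InCell`/`CellHC` of Sketch
P1AK-CELLS, curried), `HodgeConjectureFor 4 X`. Local notation only. -/
local notation3 (prettyPrint := false) "CellHC[" ρ ", " d "]" =>
  (∀ (X : SchemeOver ℂ), IsSmoothProjective 4 X → IsOfK3HilbertSquareType X →
    ∀ (φ : complexBetti X 2 ≃ₗ[ℂ] (K3HilbertIndex → ℂ)) (P : complexBetti X (2 * 4)) (z : K3HilbertIndex → ℂ),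
      MarkedK3Sq[X, φ, P, z] → ¬ SpIso[X, φ] → Module.finrank ℂ ↥(algebraicClasses X 1) = ρ →
        RMgen[X, φ, z, d] → HodgeConjectureFor 4 X)

/-- **The arithmetic of the split**: `ρ ≤ 3`, `d ≥ 2`, `n ≥ 3`, `d · n + ρ = 23` force the six cells
`(ρ, d) ∈ {(1,2), (2,3), (2,7), (3,2), (3,4), (3,5)}`; `ρ = 0` is excluded because `23` is prime (Sketch P1AK-CELLS,
planner p1 g38; `eq_two_of_mul_eq` / `eq_three_or_seven_of_mul_eq` / `eq_two_four_five_of_mul_eq`). [folklore] -/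
theorem cell_cases {ρ d n : ℕ} (hρ : ρ ≤ 3) (hd : 2 ≤ d) (hn : 3 ≤ n) (h : d * n + ρ = 23) :
    (ρ = 1 ∧ d = 2) ∨ (ρ = 2 ∧ (d = 3 ∨ d = 7)) ∨ (ρ = 3 ∧ (d = 2 ∨ d = 4 ∨ d = 5)) := by
  -- adapted from Sketch P1AK-CELLS `cell_cases` (planner p1 g38), kernel-checked there
  interval_cases ρ
  · exfalso
    have h23 : d * n = 23 := by omega
    have hdvd : d ∣ 23 := ⟨n, h23.symm⟩
    have hprime : Nat.Prime 23 := by norm_num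
    rcases (Nat.dvd_prime hprime).1 hdvd with h1 | h1 <;> subst h1
    · omega
    · nlinarith
  · exact Or.inl ⟨rfl, eq_two_of_mul_eq hd hn (by omega)⟩
  · exact Or.inr (Or.inl ⟨rfl, eq_three_or_seven_of_mul_eq hd hn (by omega)⟩)
  · exact Or.inr (Or.inr ⟨rfl, eq_two_four_five_of_mul_eq hd hn (by omega)⟩)

/-- **«CELL-SPLIT»: crux #5 `LowPicardRealMultiplication` BY NAME from HC⁴ on its six cells** `(ρ(X), [E:ℚ]) ∈
{(1,2), (2,3), (2,7), (3,2), (3,4), (3,5)}`: unfold the route declaration, take the generator and its degree `d`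
from «RM-GEN» (`exists_rmGenerator_of_not_spannedByIsometries`), and pin `(ρ(X), d)` by `cell_cases`. No named
fact. [cite: Vangeemen2008, Lemma 3.2] [cite: Zarhin1983HodgeGroupsK3, Thm. 1.5.1] -/
theorem lowPicardRealMultiplication_of_six_cells (h12 : CellHC[1, 2]) (h23 : CellHC[2, 3]) (h27 : CellHC[2, 7])
    (h32 : CellHC[3, 2]) (h34 : CellHC[3, 4]) (h35 : CellHC[3, 5]) :
    Summit.HodgeConjecture.HodgeConjecture.Theses.MarkmanPartnerTransport.LowPicardRealMultiplication := by
  intro X hX hK φ P z hM hsp hρ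
  obtain ⟨d, hd2, hgen⟩ := exists_rmGenerator_of_not_spannedByIsometries hX hM hsp
  obtain ⟨-, -, -, -, -, -, -, -, ⟨n, hn, hdn⟩, -⟩ := id hgen
  rcases cell_cases hρ hd2 hn hdn with ⟨hρ', rfl⟩ | ⟨hρ', rfl | rfl⟩ | ⟨hρ', rfl | rfl | rfl⟩
  · exact h12 X hX hK φ P z hM hsp hρ' hgen
  · exact h23 X hX hK φ P z hM hsp hρ' hgen
  · exact h27 X hX hK φ P z hM hsp hρ' hgen
  · exact h32 X hX hK φ P z hM hsp hρ' hgen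
  · exact h34 X hX hK φ P z hM hsp hρ' hgen
  · exact h35 X hX hK φ P z hM hsp hρ' hgen

/-! ### «RM-EXACT» (appended, gen 14): the six-cell decomposition of crux #5 is lossless -/

/-- **`¬ SpannedByIsometries ⟺ ∃ d ≥ 2, RMgen`** on a marked smooth projective `(X, φ, P, z)`: «RM-GEN»
(`exists_rmGenerator_of_not_spannedByIsometries`) and «RM-EXACT» (`not_spannedByIsometries_of_rmGenerator`,
`…LowPicardRMExact`). So crux #5 is EXACTLY the conjunction of HC⁴ on its six cells. No named fact.
[cite: Zarhin1983HodgeGroupsK3, Thm. 1.5.1 and Thm. 1.6] [cite: Vangeemen2008, Lemma 3.2] -/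
theorem not_spannedByIsometries_iff_exists_rmGenerator (hX : IsSmoothProjective 4 X) (hM : MarkedK3Sq[X, φ, P, z]) :
    ¬ SpIso[X, φ] ↔ ∃ d : ℕ, 2 ≤ d ∧ RMgen[X, φ, z, d] :=
  ⟨exists_rmGenerator_of_not_spannedByIsometries hX hM,
    fun ⟨_, hd, hR⟩ => not_spannedByIsometries_of_rmGenerator hX hM hd hR⟩

end Summit.HodgeConjecture.HodgeConjecture.Theorems.MarkmanPartnerTransport.PartnerLattice

end
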